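import Summits.CriticalPhenomena.PercolationContinuityZ3.Theorems.Transplant.SkelNegBParamsFaceFloorsFAYA
import Summits.CriticalPhenomena.PercolationContinuityZ3.Theorems.Transplant.SkelNegBParamsFaceFloorsFBYA
import Summits.CriticalPhenomena.PercolationContinuityZ3.Theorems.Transplant.SkelNegBParamsFaceFloorsFTYA
import Summits.CriticalPhenomena.PercolationContinuityZ3.Theorems.Transplant.SkelNegBParamsFaceCountsRangeYA
import Summits.CriticalPhenomena.PercolationContinuityZ3.Theorems.Transplant.SkelNegBParamsFaceCountsShiftYA
import HarnessLib

/-!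
# N1 params, M3 y′-FACE — **THE STMT SHARE PINNED AT THE COUNTS** (the twelve adapters `FA1–FA6`, `FT1–FT6` of `Skelφ.FloorsY2` for the assembler):
# for a GENERIC landing origin `yL` with the readings `he0 : |FcA yL| ≤ 6·u₀A`, `he1 : |F1cA yL| ≤ 6·u₁A`, `hΛ₁ : |Λ₁of yL| ≤ 3m` (served at the origins of
# record `yLFs/yLFd/yLFt` by `KS.he_yLF?`, OriginsYQA) and a GENERIC start half-height `qB′` under `hqB : 4·(U·qB′) ≤ 5·(n_Lℓ_L)` (served at `qBF` by
# `KS.four_U_qBF_le`), the run-position premises of stmt's `FA?_YA`/`FT?_YA` (FAYA/FBYA/FTYA) are DISCHARGED from hp-8's counts `NrY/σTY/N3Y` (CountsYA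
# `NrY_spec`, `N3Y_spec`, `T1Y_eq`), the cross-shift bounds (ShiftYA `F1cA_crossOffY_sub_abs_le` — the landed `2(Nr+1)+2` form suffices here: margin
# `200·Kq·u₁A` vs `1200·Kq + 2` —, `FcA_crossOffY_sub_abs_le`) and p1's ranges (RangeYA `NrY_range`, `N3Y_range`):
# * **`floorsFA_YA`** = `FloorsY2.FA1–FA4` at `Nr := NrY yL x du z`, `R's := RA′ mk`, `qB := qB′` (index-`1` form, i.e. after `rw [hd]`);
# * **`floorsFB_YA`** = `FloorsY2.FA5/FA6` at any `Nr` with `Nr + 1 ≤ 1000·Kq` (index-`0` transverse form), from `he0` and the band room `2kE + 24u₀ + 24 ≤ 5r₀`;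
# * **`tanY_pos_YA`** (the tangential x-run's nominal positions stay `10u₀ + 2` inside the transverse room) and **`floorsFT_YA`** = `FloorsY2.FT1–FT6` at
#   `yT := yL + crossOffY n_L ℓ_L h_L v_L (sgOf du) (NrY …)`, `σT := σTY yL x z`, `N₃ := N3Y yL x z`, `qB₃′ := qB3YA (RA′ mk)`.
# (stmt-g17 2026-08-22; CLAIM M3 y′/stmt-pins lane INBOX 10:40:28Z.)
builds on p205010 (kernel theorem, internal audit signed; external expert review pending) — nothing in this file uses p205010; NOTHING is claimed about the node
`SamePDropOfSkeletonNeg₁` (OPEN); arithmetic only.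
Lane `prim-bschramm-*`, seat `prim-bschramm-stmt` (gen 17); helper file (`--supports stmt-CriticalPhenomena-4575 --as helper`); slot-ledger ζ′ v3 (slot-generic here).
[cite: KozmaNitzan2024, §4 Lemma 11 (pp. 22–23), Lemma 12 (pp. 23–25)] [cite: MartineauTassion2017, §4.1]
-/

noncomputable section

open scoped Classical

namespace Summit.CriticalPhenomena.PercolationContinuityZ3.Theorems.Transplant

namespace PlanarSkeletonNeg

namespace NegB

open Literature.Probability.Percolation Literature.Probability.LatticeModels SimpleGraph
open Literature.Probability.Percolation.KozmaNitzan.Cells (sgOf sgOf_sign oth)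
open SkelConc (Consts)
open Skelφ (shearUnit shearUnit_pos yBoxLoS yBoxHiS ySLo ySHi yBnd xBoxB xSLo xSHi)
open Skelφ.StepI (DataN)
open TwoAxis.Para (modulus)
open Neg

namespace KS

section Pins

variable (κ : Consts) {V : Type} [DecidableEq V] [Countable V] {G : SimpleGraph V} [G.LocallyFinite] (Φ : PlanarSkeletonNeg G) (t : V)
  (p : unitInterval) (D : DataN V) (g f mk : ℕ)

/-- `faceL 1 j = 5r₁ + 10·u₁A·(j+1) − 1` and `u₁A·(j+1) ≤ r₁` for `j < K`. [folklore] -/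
theorem faceL1_eq (j : ℕ) (hj : j < (fcellsA κ Φ t p D g f).K) :
    (fcellsA κ Φ t p D g f).faceL 1 j = 5 * ((fcellsA κ Φ t p D g f).r 1 : ℤ) + 10 * u₁A κ Φ t p D g f * ((j : ℤ) + 1) - 1 ∧
      u₁A κ Φ t p D g f * ((j : ℤ) + 1) ≤ ((fcellsA κ Φ t p D g f).r 1 : ℤ) := by
  constructor
  · unfold PCells2.faceL u₁A; push_cast; ring
  · have hj' : ((j : ℤ) + 1) ≤ ((fcellsA κ Φ t p D g f).K : ℤ) := by exact_mod_cast hj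
    rw [PCells2.r_eq]; unfold u₁A; nlinarith [(fcellsA κ Φ t p D g f).hs 1]

/-- **THE ALONG FLOORS `FA1`–`FA4` OF THE y′-FACE AT THE COUNT `NrY`** (generic origin `yL` with `|F1cA yL| ≤ 6u₁A`, `|Λ₁ yL| ≤ 3m`; generic `qB′`
under `4·U·qB′ ≤ 5·n_Lℓ_L`). [cite: KozmaNitzan2024, §4 Lemma 12 (pp. 23–25)] -/
theorem floorsFA_YA (hN : EqNumL κ Φ t p D g f) (hκ : (hL κ Φ t p D g f).natAbs ≤ 10 * nL κ Φ t p D g f)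
    (hℓ : 22000 * Neg.Kq κ * (RA' κ Φ t p D mk + 2) ≤ ℓL κ Φ t p D g f) (hs1 : 6 * (RA' κ Φ t p D mk : ℤ) + 11 ≤ u₁A κ Φ t p D g f)
    (x : Site 2) (du : MDir) (hd : du.1 = 1) (j : ℕ) (hj : j < (fcellsA κ Φ t p D g f).K) (z : Site 2) {E : ℕ}
    (hlev1 : (fcellsA κ Φ t p D g f).faceL 1 j - E ≤ (fcellsA κ Φ t p D g f).lev du x z)
    (hlev2 : (fcellsA κ Φ t p D g f).lev du x z ≤ (fcellsA κ Φ t p D g f).faceL 1 j + E) (hE2 : (E : ℤ) ≤ 2 * (RA' κ Φ t p D mk : ℤ))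
    (yL : Site 2) (he1 : |F1cA κ Φ t p D g f yL| ≤ 6 * u₁A κ Φ t p D g f)
    (hΛ₁ : |Λ₁of κ Φ t p D g f yL| ≤ 3 * modulus (nL κ Φ t p D g f) (hL κ Φ t p D g f) (vL κ Φ t p D g f) (vβL κ Φ t p D g f)) {qB : ℕ}
    (hqB : 4 * ((shearUnit (nL κ Φ t p D g f) (hL κ Φ t p D g f) : ℤ) * (qB : ℤ)) ≤ 5 * ((nL κ Φ t p D g f : ℤ) * ℓL κ Φ t p D g f)) :
    (sgOf du = 1 → ∀ k ≤ NrY κ Φ t p D g f yL x du z,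
      modulus (nL κ Φ t p D g f) (hL κ Φ t p D g f) (vL κ Φ t p D g f) (vβL κ Φ t p D g f) *
          ((5 * ((fcellsA κ Φ t p D g f).r 1 : ℤ) + 10 * u₁A κ Φ t p D g f * (j : ℤ) + 3 - (fcellsA κ Φ t p D g f).lev du x z) - F1cA κ Φ t p D g f yL) ≤
        u₁A κ Φ t p D g f * ((shearUnit (nL κ Φ t p D g f) (hL κ Φ t p D g f) : ℤ) *
            (ySLo (nL κ Φ t p D g f) (ℓL κ Φ t p D g f) (hL κ Φ t p D g f) qB (RA' κ Φ t p D mk) 1 k - 1)) -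
          modulus (nL κ Φ t p D g f) (hL κ Φ t p D g f) (vL κ Φ t p D g f) (vβL κ Φ t p D g f) + 1) ∧
    (sgOf du = 1 → ∀ k ≤ NrY κ Φ t p D g f yL x du z,
      modulus (nL κ Φ t p D g f) (hL κ Φ t p D g f) (vL κ Φ t p D g f) (vβL κ Φ t p D g f) * (F1cA κ Φ t p D g f yL + 1) +
          u₁A κ Φ t p D g f * ((shearUnit (nL κ Φ t p D g f) (hL κ Φ t p D g f) : ℤ) *
              ySHi (nL κ Φ t p D g f) (ℓL κ Φ t p D g f) (hL κ Φ t p D g f) qB (RA' κ Φ t p D mk) 1 k +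
            shearUnit (nL κ Φ t p D g f) (hL κ Φ t p D g f) - 1) ≤
        modulus (nL κ Φ t p D g f) (hL κ Φ t p D g f) (vL κ Φ t p D g f) (vβL κ Φ t p D g f) *
          (25 * ((fcellsA κ Φ t p D g f).r 1 : ℤ) - 2 - (fcellsA κ Φ t p D g f).lev du x z)) ∧
    (sgOf du = -1 → ∀ k ≤ NrY κ Φ t p D g f yL x du z,
      modulus (nL κ Φ t p D g f) (hL κ Φ t p D g f) (vL κ Φ t p D g f) (vβL κ Φ t p D g f) *
          ((5 * ((fcellsA κ Φ t p D g f).r 1 : ℤ) + 10 * u₁A κ Φ t p D g f * (j : ℤ) + 3 - (fcellsA κ Φ t p D g f).lev du x z) + F1cA κ Φ t p D g f yL + 1) ≤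
        -(u₁A κ Φ t p D g f * ((shearUnit (nL κ Φ t p D g f) (hL κ Φ t p D g f) : ℤ) *
              ySHi (nL κ Φ t p D g f) (ℓL κ Φ t p D g f) (hL κ Φ t p D g f) qB (RA' κ Φ t p D mk) (-1) k +
            shearUnit (nL κ Φ t p D g f) (hL κ Φ t p D g f) - 1))) ∧
    (sgOf du = -1 → ∀ k ≤ NrY κ Φ t p D g f yL x du z,
      -(modulus (nL κ Φ t p D g f) (hL κ Φ t p D g f) (vL κ Φ t p D g f) (vβL κ Φ t p D g f) * F1cA κ Φ t p D g f yL) -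
            u₁A κ Φ t p D g f * ((shearUnit (nL κ Φ t p D g f) (hL κ Φ t p D g f) : ℤ) *
              (ySLo (nL κ Φ t p D g f) (ℓL κ Φ t p D g f) (hL κ Φ t p D g f) qB (RA' κ Φ t p D mk) (-1) k - 1)) +
          modulus (nL κ Φ t p D g f) (hL κ Φ t p D g f) (vL κ Φ t p D g f) (vβL κ Φ t p D g f) - 1 ≤
        modulus (nL κ Φ t p D g f) (hL κ Φ t p D g f) (vL κ Φ t p D g f) (vβL κ Φ t p D g f) *
          (25 * ((fcellsA κ Φ t p D g f).r 1 : ℤ) - 2 - (fcellsA κ Φ t p D g f).lev du x z)) := by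
  have hσ : sgOf du = 1 ∨ sgOf du = -1 := sgOf_sign du
  have hu1 : 1 ≤ u₁A κ Φ t p D g f := (units_eqA κ Φ t p D g f).2.2.2.2.2.2.2
  have hKq : 1 ≤ Neg.Kq κ := Neg.one_le_Kq κ
  have hR0 : (0 : ℤ) ≤ (RA' κ Φ t p D mk : ℤ) := by positivity
  obtain ⟨hfl, -⟩ := faceL1_eq κ Φ t p D g f j hj
  have hlev : 5 * ((fcellsA κ Φ t p D g f).r 1 : ℤ) + 10 * u₁A κ Φ t p D g f * ((j : ℤ) + 1) - 1 - E ≤ (fcellsA κ Φ t p D g f).lev du x z := by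
    rw [← hfl]; exact hlev1
  obtain ⟨hX, hNr600⟩ := NrY_range κ Φ t p D g f x du hd z hj hlev1 hlev2 yL he1 (by linarith)
  have hNr1000 : NrY κ Φ t p D g f yL x du z + 1 ≤ 1000 * Neg.Kq κ := by omega
  have hkN : ∀ k ≤ NrY κ Φ t p D g f yL x du z, k + 1 ≤ 1000 * Neg.Kq κ := fun k hk => by omega
  obtain ⟨-, hT2⟩ := NrY_spec κ Φ t p D g f yL x du z hX
  have hT0 := T1Y_eq κ Φ t p D g f x du hd z
  refine ⟨fun _ k hk => FA1_YA κ Φ t p D g f mk hN hκ hℓ hs1 yL hΛ₁ hqB hE2 hlev (hkN k hk), fun hσ1 k hk => ?_,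
    fun _ k hk => FA3_YA κ Φ t p D g f mk hN hκ hℓ hs1 yL hΛ₁ hqB hE2 hlev (hkN k hk), fun hσ1 k hk => ?_⟩
  · rw [hσ1, one_mul] at hT2 hT0
    have hfar : F1cA κ Φ t p D g f yL + u₁A κ Φ t p D g f * ((NrY κ Φ t p D g f yL x du z : ℤ) + 1) ≤
        20 * ((fcellsA κ Φ t p D g f).r 1 : ℤ) - (fcellsA κ Φ t p D g f).lev du x z + 2 * u₁A κ Φ t p D g f := by linarith
    exact FA2_YA κ Φ t p D g f mk hN hκ hℓ yL hqB hNr1000 hfar hk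
  · rw [hσ1, neg_one_mul] at hT2 hT0
    have hfar : -F1cA κ Φ t p D g f yL + u₁A κ Φ t p D g f * ((NrY κ Φ t p D g f yL x du z : ℤ) + 1) ≤
        20 * ((fcellsA κ Φ t p D g f).r 1 : ℤ) - (fcellsA κ Φ t p D g f).lev du x z + 2 * u₁A κ Φ t p D g f := by linarith
    exact FA4_YA κ Φ t p D g f mk hN hκ hℓ yL hqB hNr1000 hfar hk

/-- **THE ALONG RUN's TRANSVERSE FLOORS `FA5`/`FA6` OF THE y′-FACE** (generic origin `yL` with `|FcA yL| ≤ 6u₀A`; transverse index `0`; band room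
`2kE + 24u₀ + 24 ≤ 5r₀`). [cite: KozmaNitzan2024, §4 Lemma 12 (pp. 23–25)] -/
theorem floorsFB_YA (hN : EqNumL κ Φ t p D g f) (hκ : (hL κ Φ t p D g f).natAbs ≤ 10 * nL κ Φ t p D g f)
    (hnA : 2000 * Neg.Kq κ * (RA' κ Φ t p D mk + 2) ≤ nL κ Φ t p D g f) (hℓ : 22000 * Neg.Kq κ * (RA' κ Φ t p D mk + 2) ≤ ℓL κ Φ t p D g f)
    (x z yL : Site 2) (he0 : |FcA κ Φ t p D g f yL| ≤ 6 * u₀A κ Φ t p D g f) {kE : ℤ} (hz : |z 0 - (fcellsA κ Φ t p D g f).cen x 0| ≤ kE)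
    (hkE24 : 2 * kE + 24 * u₀A κ Φ t p D g f + 24 ≤ 5 * ((fcellsA κ Φ t p D g f).r 0 : ℤ)) {qB : ℕ}
    (hqB : 4 * ((shearUnit (nL κ Φ t p D g f) (hL κ Φ t p D g f) : ℤ) * (qB : ℤ)) ≤ 5 * ((nL κ Φ t p D g f : ℤ) * ℓL κ Φ t p D g f))
    {Nr : ℕ} (hNr : Nr + 1 ≤ 1000 * Neg.Kq κ) :
    (∀ k ≤ Nr, (nL κ Φ t p D g f : ℤ) * modulus (nL κ Φ t p D g f) (hL κ Φ t p D g f) (vL κ Φ t p D g f) (vβL κ Φ t p D g f) *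
        (-(5 * ((fcellsA κ Φ t p D g f).r 0 : ℤ) - 4 - 3 - |z 0 - (fcellsA κ Φ t p D g f).cen x 0|) - FcA κ Φ t p D g f yL) ≤
      -(u₀A κ Φ t p D g f * (yBnd (nL κ Φ t p D g f) (ℓL κ Φ t p D g f) (hL κ Φ t p D g f)
            (modulus (nL κ Φ t p D g f) (hL κ Φ t p D g f) (vL κ Φ t p D g f) (vβL κ Φ t p D g f)) qB (RA' κ Φ t p D mk) k +
          2 * (nL κ Φ t p D g f : ℤ))) -
        (nL κ Φ t p D g f : ℤ) * modulus (nL κ Φ t p D g f) (hL κ Φ t p D g f) (vL κ Φ t p D g f) (vβL κ Φ t p D g f)) ∧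
    (∀ k ≤ Nr, (nL κ Φ t p D g f : ℤ) * modulus (nL κ Φ t p D g f) (hL κ Φ t p D g f) (vL κ Φ t p D g f) (vβL κ Φ t p D g f) * (FcA κ Φ t p D g f yL + 1) +
        u₀A κ Φ t p D g f * (yBnd (nL κ Φ t p D g f) (ℓL κ Φ t p D g f) (hL κ Φ t p D g f)
            (modulus (nL κ Φ t p D g f) (hL κ Φ t p D g f) (vL κ Φ t p D g f) (vβL κ Φ t p D g f)) qB (RA' κ Φ t p D mk) k +
          (nL κ Φ t p D g f : ℤ)) ≤
      (nL κ Φ t p D g f : ℤ) * modulus (nL κ Φ t p D g f) (hL κ Φ t p D g f) (vL κ Φ t p D g f) (vβL κ Φ t p D g f) *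
        (5 * ((fcellsA κ Φ t p D g f).r 0 : ℤ) - 4 - 3 - |z 0 - (fcellsA κ Φ t p D g f).cen x 0|)) := by
  have hkN : ∀ k ≤ Nr, k + 1 ≤ 1000 * Neg.Kq κ := fun k hk => by omega
  obtain ⟨e1, e2⟩ := abs_le.1 he0
  have ha0 : 0 ≤ |z 0 - (fcellsA κ Φ t p D g f).cen x 0| := abs_nonneg _
  have hlo : -(5 * ((fcellsA κ Φ t p D g f).r 0 : ℤ) - 4 - 3 - |z 0 - (fcellsA κ Φ t p D g f).cen x 0|) + 9 * u₀A κ Φ t p D g f + 1 ≤ FcA κ Φ t p D g f yL := by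
    linarith
  have hhi : FcA κ Φ t p D g f yL + 9 * u₀A κ Φ t p D g f + 1 ≤ 5 * ((fcellsA κ Φ t p D g f).r 0 : ℤ) - 4 - 3 - |z 0 - (fcellsA κ Φ t p D g f).cen x 0| := by
    linarith
  exact ⟨fun k hk => FA5_YA κ Φ t p D g f mk hN hκ hnA hℓ yL x z 0 hqB (hkN k hk) hlo,
    fun k hk => FA6_YA κ Φ t p D g f mk hN hκ hnA hℓ yL x z 0 hqB (hkN k hk) hhi⟩

/-- **The tangential x-run's nominal positions stay inside the transverse room** (y′-face): for `k ≤ N3Y`, `F′ + σT·u₀·k` lies between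
`−(5r₀ − 7 − |z₀ − cen₀|) + 10u₀ + 2` and `5r₀ − 7 − |z₀ − cen₀| − 10u₀ − 2` (`|FcA yL| ≤ 6u₀`, `|F′ − FcA yL| ≤ u₀`, `2kE + 24u₀ + 24 ≤ 5r₀`). [folklore] -/
theorem tanY_pos_YA (x z yL : Site 2) {kE : ℤ} (hz : |z 0 - (fcellsA κ Φ t p D g f).cen x 0| ≤ kE)
    (hkE24 : 2 * kE + 24 * u₀A κ Φ t p D g f + 24 ≤ 5 * ((fcellsA κ Φ t p D g f).r 0 : ℤ)) (hu : 1 ≤ u₀A κ Φ t p D g f)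
    (he0 : |FcA κ Φ t p D g f yL| ≤ 6 * u₀A κ Φ t p D g f) (F' : ℤ) (hF' : |F' - FcA κ Φ t p D g f yL| ≤ u₀A κ Φ t p D g f) :
    ∀ k ≤ N3Y κ Φ t p D g f yL x z,
      -(5 * ((fcellsA κ Φ t p D g f).r 0 : ℤ) - 4 - 3 - |z 0 - (fcellsA κ Φ t p D g f).cen x 0|) + 10 * u₀A κ Φ t p D g f + 2 ≤
          F' + σTY κ Φ t p D g f yL x z * u₀A κ Φ t p D g f * (k : ℤ) ∧
        F' + σTY κ Φ t p D g f yL x z * u₀A κ Φ t p D g f * (k : ℤ) + 10 * u₀A κ Φ t p D g f + 2 ≤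
          5 * ((fcellsA κ Φ t p D g f).r 0 : ℤ) - 4 - 3 - |z 0 - (fcellsA κ Φ t p D g f).cen x 0| := by
  intro k hk
  obtain ⟨-, hN1, -⟩ := N3Y_spec κ Φ t p D g f yL x z
  have hcase : (σTY κ Φ t p D g f yL x z = 1 ∧ FcA κ Φ t p D g f yL ≤ T0Y κ Φ t p D g f x z) ∨
      (σTY κ Φ t p D g f yL x z = -1 ∧ T0Y κ Φ t p D g f x z < FcA κ Φ t p D g f yL) := by
    unfold σTY; split_ifs with h
    · exact Or.inl ⟨rfl, h⟩
    · exact Or.inr ⟨rfl, lt_of_not_ge h⟩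
  have hk' : (k : ℤ) ≤ (N3Y κ Φ t p D g f yL x z : ℤ) := by exact_mod_cast hk
  have hT : |T0Y κ Φ t p D g f x z| = |z 0 - (fcellsA κ Φ t p D g f).cen x 0| := by unfold T0Y; rw [abs_sub_comm]
  have ha0 : 0 ≤ |z 0 - (fcellsA κ Φ t p D g f).cen x 0| := abs_nonneg _
  obtain ⟨e1, e2⟩ := abs_le.1 he0
  obtain ⟨f1, f2⟩ := abs_le.1 hF'
  have hTle : |T0Y κ Φ t p D g f x z| ≤ kE := hT ▸ hz
  rw [← hT]
  generalize σTY κ Φ t p D g f yL x z = σ' at hcase ⊢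
  generalize T0Y κ Φ t p D g f x z = T at hN1 hTle hcase ⊢
  generalize FcA κ Φ t p D g f yL = F₀ at hN1 e1 e2 f1 f2 hcase ⊢
  generalize u₀A κ Φ t p D g f = u at hkE24 hu hN1 e1 e2 f1 f2 ⊢
  generalize (N3Y κ Φ t p D g f yL x z : ℤ) = N at hN1 hk'
  have hku : u * (k : ℤ) ≤ u * N := mul_le_mul_of_nonneg_left hk' (by linarith)
  have hk0 : 0 ≤ u * (k : ℤ) := mul_nonneg (by linarith) (by positivity)
  have hTabs : -|T| ≤ T ∧ T ≤ |T| := ⟨neg_abs_le T, le_abs_self T⟩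
  have hT0 : 0 ≤ |T| := abs_nonneg T
  rcases hcase with ⟨rfl, hFT⟩ | ⟨rfl, hFT⟩
  · rw [abs_of_nonneg (by linarith)] at hN1
    constructor <;> nlinarith [hTabs.1, hTabs.2]
  · rw [abs_of_neg (by linarith)] at hN1
    constructor <;> nlinarith [hTabs.1, hTabs.2]

/-- **THE TANGENTIAL FLOORS `FT1`–`FT6` OF THE y′-FACE AT THE COUNTS** (`yT := yL + crossOffY … (sgOf du) NrY`, `σT := σTY`, `N₃ := N3Y`,
`qB₃′ := qB3YA (RA′ mk)`; generic origin `yL` with `|FcA yL| ≤ 6u₀A`, `|F1cA yL| ≤ 6u₁A`). [cite: KozmaNitzan2024, §4 Lemma 12 (pp. 23–25)] -/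
theorem floorsFT_YA (hN : EqNumL κ Φ t p D g f) (hκ : (hL κ Φ t p D g f).natAbs ≤ 10 * nL κ Φ t p D g f)
    (hnA : 2000 * Neg.Kq κ * (RA' κ Φ t p D mk + 2) ≤ nL κ Φ t p D g f) (hℓ : 22000 * Neg.Kq κ * (RA' κ Φ t p D mk + 2) ≤ ℓL κ Φ t p D g f)
    (hs0 : 6 * (RA' κ Φ t p D mk : ℤ) + 11 ≤ u₀A κ Φ t p D g f) (hs1 : 6 * (RA' κ Φ t p D mk : ℤ) + 11 ≤ u₁A κ Φ t p D g f)
    (x : Site 2) (du : MDir) (hd : du.1 = 1) (j : ℕ) (hj : j < (fcellsA κ Φ t p D g f).K) (z : Site 2) {E : ℕ} {kE : ℤ}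
    (hlev1 : (fcellsA κ Φ t p D g f).faceL 1 j - E ≤ (fcellsA κ Φ t p D g f).lev du x z)
    (hlev2 : (fcellsA κ Φ t p D g f).lev du x z ≤ (fcellsA κ Φ t p D g f).faceL 1 j + E) (hE2 : (E : ℤ) ≤ 2 * (RA' κ Φ t p D mk : ℤ))
    (hz : |z 0 - (fcellsA κ Φ t p D g f).cen x 0| ≤ kE) (hkE : kE ≤ 5 * ((fcellsA κ Φ t p D g f).r 0 : ℤ))
    (hkE24 : 2 * kE + 24 * u₀A κ Φ t p D g f + 24 ≤ 5 * ((fcellsA κ Φ t p D g f).r 0 : ℤ))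
    (yL : Site 2) (he0 : |FcA κ Φ t p D g f yL| ≤ 6 * u₀A κ Φ t p D g f) (he1 : |F1cA κ Φ t p D g f yL| ≤ 6 * u₁A κ Φ t p D g f) :
    (sgOf du = 1 → ∀ k ≤ N3Y κ Φ t p D g f yL x z,
      modulus (nL κ Φ t p D g f) (hL κ Φ t p D g f) (vL κ Φ t p D g f) (vβL κ Φ t p D g f) *
          ((5 * ((fcellsA κ Φ t p D g f).r 1 : ℤ) + 10 * u₁A κ Φ t p D g f * (j : ℤ) + 3 - (fcellsA κ Φ t p D g f).lev du x z) -
            F1cA κ Φ t p D g f (yL + Skelφ.crossOffY (nL κ Φ t p D g f) (ℓL κ Φ t p D g f) (hL κ Φ t p D g f) (vL κ Φ t p D g f) (sgOf du) (NrY κ Φ t p D g f yL x du z))) ≤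
        -(u₁A κ Φ t p D g f * (shearUnit (nL κ Φ t p D g f) (hL κ Φ t p D g f) : ℤ) *
            (xBoxB (nL κ Φ t p D g f) (ℓL κ Φ t p D g f) (hL κ Φ t p D g f) (RA' κ Φ t p D mk) k + 1)) -
          modulus (nL κ Φ t p D g f) (hL κ Φ t p D g f) (vL κ Φ t p D g f) (vβL κ Φ t p D g f) + 1) ∧
    (sgOf du = 1 → ∀ k ≤ N3Y κ Φ t p D g f yL x z,
      modulus (nL κ Φ t p D g f) (hL κ Φ t p D g f) (vL κ Φ t p D g f) (vβL κ Φ t p D g f) *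
            (F1cA κ Φ t p D g f (yL + Skelφ.crossOffY (nL κ Φ t p D g f) (ℓL κ Φ t p D g f) (hL κ Φ t p D g f) (vL κ Φ t p D g f) (sgOf du) (NrY κ Φ t p D g f yL x du z)) + 1) +
          u₁A κ Φ t p D g f * ((shearUnit (nL κ Φ t p D g f) (hL κ Φ t p D g f) : ℤ) *
              xBoxB (nL κ Φ t p D g f) (ℓL κ Φ t p D g f) (hL κ Φ t p D g f) (RA' κ Φ t p D mk) k + shearUnit (nL κ Φ t p D g f) (hL κ Φ t p D g f) - 1) ≤
        modulus (nL κ Φ t p D g f) (hL κ Φ t p D g f) (vL κ Φ t p D g f) (vβL κ Φ t p D g f) * (25 * ((fcellsA κ Φ t p D g f).r 1 : ℤ) - 2 - (fcellsA κ Φ t p D g f).lev du x z)) ∧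
    (sgOf du = -1 → ∀ k ≤ N3Y κ Φ t p D g f yL x z,
      modulus (nL κ Φ t p D g f) (hL κ Φ t p D g f) (vL κ Φ t p D g f) (vβL κ Φ t p D g f) *
          ((5 * ((fcellsA κ Φ t p D g f).r 1 : ℤ) + 10 * u₁A κ Φ t p D g f * (j : ℤ) + 3 - (fcellsA κ Φ t p D g f).lev du x z) +
            F1cA κ Φ t p D g f (yL + Skelφ.crossOffY (nL κ Φ t p D g f) (ℓL κ Φ t p D g f) (hL κ Φ t p D g f) (vL κ Φ t p D g f) (sgOf du) (NrY κ Φ t p D g f yL x du z)) + 1) ≤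
        -(u₁A κ Φ t p D g f * ((shearUnit (nL κ Φ t p D g f) (hL κ Φ t p D g f) : ℤ) *
            xBoxB (nL κ Φ t p D g f) (ℓL κ Φ t p D g f) (hL κ Φ t p D g f) (RA' κ Φ t p D mk) k + shearUnit (nL κ Φ t p D g f) (hL κ Φ t p D g f) - 1))) ∧
    (sgOf du = -1 → ∀ k ≤ N3Y κ Φ t p D g f yL x z,
      -(modulus (nL κ Φ t p D g f) (hL κ Φ t p D g f) (vL κ Φ t p D g f) (vβL κ Φ t p D g f) *
              F1cA κ Φ t p D g f (yL + Skelφ.crossOffY (nL κ Φ t p D g f) (ℓL κ Φ t p D g f) (hL κ Φ t p D g f) (vL κ Φ t p D g f) (sgOf du) (NrY κ Φ t p D g f yL x du z))) +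
            u₁A κ Φ t p D g f * (shearUnit (nL κ Φ t p D g f) (hL κ Φ t p D g f) : ℤ) *
              (xBoxB (nL κ Φ t p D g f) (ℓL κ Φ t p D g f) (hL κ Φ t p D g f) (RA' κ Φ t p D mk) k + 1) +
          modulus (nL κ Φ t p D g f) (hL κ Φ t p D g f) (vL κ Φ t p D g f) (vβL κ Φ t p D g f) - 1 ≤
        modulus (nL κ Φ t p D g f) (hL κ Φ t p D g f) (vL κ Φ t p D g f) (vβL κ Φ t p D g f) * (25 * ((fcellsA κ Φ t p D g f).r 1 : ℤ) - 2 - (fcellsA κ Φ t p D g f).lev du x z)) ∧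
    (∀ k ≤ N3Y κ Φ t p D g f yL x z,
      (nL κ Φ t p D g f : ℤ) * modulus (nL κ Φ t p D g f) (hL κ Φ t p D g f) (vL κ Φ t p D g f) (vβL κ Φ t p D g f) *
          (-(5 * ((fcellsA κ Φ t p D g f).r 0 : ℤ) - 4 - 3 - |z 0 - (fcellsA κ Φ t p D g f).cen x 0|) -
            FcA κ Φ t p D g f (yL + Skelφ.crossOffY (nL κ Φ t p D g f) (ℓL κ Φ t p D g f) (hL κ Φ t p D g f) (vL κ Φ t p D g f) (sgOf du) (NrY κ Φ t p D g f yL x du z))) ≤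
        u₀A κ Φ t p D g f * modulus (nL κ Φ t p D g f) (hL κ Φ t p D g f) (vL κ Φ t p D g f) (vβL κ Φ t p D g f) *
              xSLo (nL κ Φ t p D g f) (qB3YA κ Φ t p D g f (RA' κ Φ t p D mk)) (RA' κ Φ t p D mk) (σTY κ Φ t p D g f yL x z) k -
            u₀A κ Φ t p D g f * (nL κ Φ t p D g f : ℤ) * (shearUnit (nL κ Φ t p D g f) (hL κ Φ t p D g f) : ℤ) *
              (xBoxB (nL κ Φ t p D g f) (ℓL κ Φ t p D g f) (hL κ Φ t p D g f) (RA' κ Φ t p D mk) k + 1) -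
          u₀A κ Φ t p D g f * (nL κ Φ t p D g f : ℤ) -
          (nL κ Φ t p D g f : ℤ) * modulus (nL κ Φ t p D g f) (hL κ Φ t p D g f) (vL κ Φ t p D g f) (vβL κ Φ t p D g f)) ∧
    (∀ k ≤ N3Y κ Φ t p D g f yL x z,
      (nL κ Φ t p D g f : ℤ) * modulus (nL κ Φ t p D g f) (hL κ Φ t p D g f) (vL κ Φ t p D g f) (vβL κ Φ t p D g f) *
            (FcA κ Φ t p D g f (yL + Skelφ.crossOffY (nL κ Φ t p D g f) (ℓL κ Φ t p D g f) (hL κ Φ t p D g f) (vL κ Φ t p D g f) (sgOf du) (NrY κ Φ t p D g f yL x du z)) + 1) +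
            u₀A κ Φ t p D g f * modulus (nL κ Φ t p D g f) (hL κ Φ t p D g f) (vL κ Φ t p D g f) (vβL κ Φ t p D g f) *
              xSHi (nL κ Φ t p D g f) (qB3YA κ Φ t p D g f (RA' κ Φ t p D mk)) (RA' κ Φ t p D mk) (σTY κ Φ t p D g f yL x z) k +
          u₀A κ Φ t p D g f * (nL κ Φ t p D g f : ℤ) * (shearUnit (nL κ Φ t p D g f) (hL κ Φ t p D g f) : ℤ) *
            (xBoxB (nL κ Φ t p D g f) (ℓL κ Φ t p D g f) (hL κ Φ t p D g f) (RA' κ Φ t p D mk) k + 1) ≤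
        (nL κ Φ t p D g f : ℤ) * modulus (nL κ Φ t p D g f) (hL κ Φ t p D g f) (vL κ Φ t p D g f) (vβL κ Φ t p D g f) *
          (5 * ((fcellsA κ Φ t p D g f).r 0 : ℤ) - 4 - 3 - |z 0 - (fcellsA κ Φ t p D g f).cen x 0|)) := by
  have hσ : sgOf du = 1 ∨ sgOf du = -1 := sgOf_sign du
  have hu0 : 1 ≤ u₀A κ Φ t p D g f := (units_eqA κ Φ t p D g f).2.2.2.2.2.2.1
  have hu1 : 1 ≤ u₁A κ Φ t p D g f := (units_eqA κ Φ t p D g f).2.2.2.2.2.2.2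
  have hr1 : ((fcellsA κ Φ t p D g f).r 1 : ℤ) = 40 * (Neg.Kq κ : ℤ) * u₁A κ Φ t p D g f := (units_eqA κ Φ t p D g f).2.2.2.1
  have hKq : 1 ≤ Neg.Kq κ := Neg.one_le_Kq κ
  have hKq' : (1 : ℤ) ≤ (Neg.Kq κ : ℤ) := by exact_mod_cast hKq
  have hR0 : (0 : ℤ) ≤ (RA' κ Φ t p D mk : ℤ) := by positivity
  obtain ⟨hfl, hjr⟩ := faceL1_eq κ Φ t p D g f j hj
  obtain ⟨hX, hNr600⟩ := NrY_range κ Φ t p D g f x du hd z hj hlev1 hlev2 yL he1 (by linarith)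
  obtain ⟨hT1, -⟩ := NrY_spec κ Φ t p D g f yL x du z hX
  have hT0 := T1Y_eq κ Φ t p D g f x du hd z
  have hN3 := N3Y_range κ Φ t p D g f yL x z hz hkE he0 (by linarith)
  have hk3 : ∀ k ≤ N3Y κ Φ t p D g f yL x z, k + 1 ≤ 1000 * Neg.Kq κ := fun k hk => by omega
  obtain ⟨hσT, -, -⟩ := N3Y_spec κ Φ t p D g f yL x z
  have hNr' : ((NrY κ Φ t p D g f yL x du z : ℕ) : ℤ) + 1 ≤ 600 * (Neg.Kq κ : ℤ) := by exact_mod_cast hNr600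
  have hℓ' : 22000 * (Neg.Kq κ : ℤ) * ((RA' κ Φ t p D mk : ℤ) + 2) ≤ (ℓL κ Φ t p D g f : ℤ) := by exact_mod_cast hℓ
  have hℓN : 25 * ((NrY κ Φ t p D g f yL x du z : ℤ) + 1) + 13 ≤ (ℓL κ Φ t p D g f : ℤ) := by nlinarith
  have hD := F1cA_crossOffY_sub_abs_le κ Φ t p D g f hN hκ yL hσ (NrY κ Φ t p D g f yL x du z)
  have hF' := FcA_crossOffY_sub_abs_le κ Φ t p D g f hN hκ yL hσ (NrY κ Φ t p D g f yL x du z) hℓN (by linarith)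
  have htan := tanY_pos_YA κ Φ t p D g f x z yL hz hkE24 hu0 he0 _ hF'
  -- the along positions of the tangential origin: `|σ·F1cA yT − (20r₁ − lev)| ≤ u₁ + 2(NrY+1) + 2`
  set FT := F1cA κ Φ t p D g f (yL + Skelφ.crossOffY (nL κ Φ t p D g f) (ℓL κ Φ t p D g f) (hL κ Φ t p D g f) (vL κ Φ t p D g f) (sgOf du) (NrY κ Φ t p D g f yL x du z))
  obtain ⟨d1, d2⟩ := abs_le.1 hD
  obtain ⟨t1, t2⟩ := abs_le.1 hT1
  have hlev_lo : 5 * ((fcellsA κ Φ t p D g f).r 1 : ℤ) + 10 * u₁A κ Φ t p D g f * ((j : ℤ) + 1) - 1 - E ≤ (fcellsA κ Φ t p D g f).lev du x z := by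
    rw [← hfl]; exact hlev1
  have hlev_hi : (fcellsA κ Φ t p D g f).lev du x z ≤ 5 * ((fcellsA κ Φ t p D g f).r 1 : ℤ) + 10 * u₁A κ Φ t p D g f * ((j : ℤ) + 1) - 1 + E := by
    rw [← hfl]; exact hlev2
  have hQu : 11 * (Neg.Kq κ : ℤ) ≤ (Neg.Kq κ : ℤ) * u₁A κ Φ t p D g f := by nlinarith
  have hKu : u₁A κ Φ t p D g f ≤ (Neg.Kq κ : ℤ) * u₁A κ Φ t p D g f := le_mul_of_one_le_left (by linarith) hKq'
  clear hF' hD hX hN3 hℓN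
  refine ⟨fun hσ1 k hk => ?_, fun hσ1 k hk => ?_, fun hσ1 k hk => ?_, fun hσ1 k hk => ?_,
    fun k hk => FT5_YA κ Φ t p D g f mk hN hκ hnA hℓ _ x z 0 hσT (hk3 k hk) (htan k hk).1,
    fun k hk => FT6_YA κ Φ t p D g f mk hN hκ hnA hℓ _ x z 0 hσT (hk3 k hk) (htan k hk).2⟩
  · rw [hσ1, one_mul] at hT0; rw [hσ1] at d1 d2 t1 t2
    have hnear : 5 * ((fcellsA κ Φ t p D g f).r 1 : ℤ) + 10 * u₁A κ Φ t p D g f * (j : ℤ) + 3 - (fcellsA κ Φ t p D g f).lev du x z + 5 * u₁A κ Φ t p D g f + 1 ≤ FT := by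
      linarith [d1, t1, hT0, hjr, hr1, hNr', hQu, hKu, hlev_lo, hu1, hKq', hE2, hR0]
    exact FT1_YA κ Φ t p D g f mk hN hκ hℓ _ (hk3 k hk) hnear
  · rw [hσ1, one_mul] at hT0; rw [hσ1] at d1 d2 t1 t2
    have hfar : FT + 5 * u₁A κ Φ t p D g f + 1 ≤ 25 * ((fcellsA κ Φ t p D g f).r 1 : ℤ) - 2 - (fcellsA κ Φ t p D g f).lev du x z := by
      linarith [d2, t2, hT0, hjr, hr1, hNr', hQu, hKu, hlev_hi, hu1, hKq', hE2, hR0]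
    exact FT2_YA κ Φ t p D g f mk hN hκ hℓ _ (hk3 k hk) hfar
  · rw [hσ1, neg_one_mul] at hT0; rw [hσ1] at d1 d2 t1 t2
    have hnear : 5 * ((fcellsA κ Φ t p D g f).r 1 : ℤ) + 10 * u₁A κ Φ t p D g f * (j : ℤ) + 3 - (fcellsA κ Φ t p D g f).lev du x z + 5 * u₁A κ Φ t p D g f + 1 ≤ -FT := by
      linarith [d2, t2, hT0, hjr, hr1, hNr', hQu, hKu, hlev_lo, hu1, hKq', hE2, hR0]
    exact FT3_YA κ Φ t p D g f mk hN hκ hℓ _ (hk3 k hk) hnear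
  · rw [hσ1, neg_one_mul] at hT0; rw [hσ1] at d1 d2 t1 t2
    have hfar : -FT + 5 * u₁A κ Φ t p D g f + 1 ≤ 25 * ((fcellsA κ Φ t p D g f).r 1 : ℤ) - 2 - (fcellsA κ Φ t p D g f).lev du x z := by
      linarith [d1, t1, hT0, hjr, hr1, hNr', hQu, hKu, hlev_hi, hu1, hKq', hE2, hR0]
    exact FT4_YA κ Φ t p D g f mk hN hκ hℓ _ (hk3 k hk) hfar

end Pins

end KS

end NegB

end PlanarSkeletonNeg

end Summit.CriticalPhenomena.PercolationContinuityZ3.Theorems.Transplant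

end
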